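import Mathlib.Order.Interval.Finset.Nat
import Mathlib.Data.Nat.Find
import Mathlib.Algebra.BigOperators.Group.Finset.Basic
import Mathlib.Algebra.BigOperators.Group.Finset.Piecewise
import Mathlib.Algebra.Order.BigOperators.Group.Finset
import Mathlib.Data.Set.Function
import Mathlib.Tactic.Linarith
import Mathlib.Tactic.Ring
import HarnessLib

/-!
# Volkov 2020 (NPB 961, 115232) §3.2 Lemmas 3.6–3.7 in the captured-photon reading — «the photons whose lepton path lies in s are at most ⌊|Lept(s)|/2⌋» and the existence of the weights r_i ∈ {0,1} of Lemma 3.7 — PROVED for every QED lepton-path skeleton without a lepton self-energy block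

independent recomputation; certified where stated, statistical where stated; no new-physics claim.

CITATION HEADER (venture `QEDPrecision`, cell `pub-qed`, track TROPICAL seat V3b = `pub-qed-trop-v3-lit-2` gen 8; VALUE-FREE: a counting lemma on
the combinatorial skeleton of a QED graph without lepton loops — no integrand, nothing per word). Companion of
`Volkov2020.DenominatorSectorExponent` (which shows, on the one-loop graph, that Lemma 3.6 read LITERALLY — all photon lines of IClos(s) — is
false, and that the paper's §3.2 needs the reading Ph(IClos(s)) := the photons CAPTURED by s); this file proves Lemma 3.6 in that reading in
general, following the printed proof. Serves `tropical/view/V3-VOLKOV-DEGREES.md` §B B.28.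

Source. [Volkov2020] S. Volkov, "Infrared and ultraviolet power counting on the mass shell in quantum electrodynamics", Nucl. Phys. B 961
(2020) 115232 = arXiv:1912.04885v4 (e-print tex `iclos_arxiv.tex` held by the cell; journal pages from the cell's SCOAP3 page files), VERBATIM:
* §2.1 (journal p.6–7; tex l.140–173): the graphs have no lepton loops — one lepton path; "We suppose that G does not have lepton cycles, and
  ω(s) < 0 for all s ⊆ E(G) except the empty set and E(G)" ("For connected sets s it equals 2 − ¾N_lepton − ½N_photon"); "If i ∈ Ph(E(G)), then by
  LPath(i) we denote the set of all lines that are on the lepton path connecting the vertexes incident to i. … IClos(s) = s ∪ {i ∈ Ph(E(G)) :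
  LPath(i) ⊆ s}."
* §3.2 **Lemma 3.6** (journal p.13; tex l.442–459): "For any s ⊆ E(G) we have |Ph(IClos(s))| ≤ ⌊|Lept(s)|/2⌋." Proof: "It is enough only to prove
  that |Ph(IClos(s))| ≤ |Lept(s)|/2. For proving this we consider Lept(s) as the union of paths h₁,…,h_l (that are not connected). There are two
  cases: • For each path h_j there exists a photon line of G (internal or external) with exactly one vertex on h_j. Taking to account that h_j
  has |h_j|+1 vertexes, and one vertex is already occupied by that photon, there are no more than |h_j|/2 photons with ends on h_j contributing
  to |Ph(IClos(s))|. • There exists a path h_j without external photon lines in regard to it. Then IClos(h_j) forms a lepton self-energy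
  subgraph [fn 24], i.e, ω(IClos(h_j)) = 1/2 > 0; this contradicts to the restrictions on G."
* §3.1 (journal p.10; tex l.290–294): "P[s] = {a ∈ P : a ⊆ s}" (P a set of disjoint unordered pairs of internal lepton lines, §2.2.1).
* §3.2 **Lemma 3.7** (journal p.14; tex l.460–484): "There exist numbers r_i ∈ {0,1} for i ∈ Ph(E(G)) such that Σ_i r_i = L + u[P] and for any
  l = 1,…,L we have Σ_{i∈Ph(IClos(s^{[l]}))} r_i ≤ ⌊Lept(s^{[l]})/2⌋ − |P[s^{[l]}]|. (3.8)" Proof: "First, we note that L + u[P] = |Ph(E(G))| − |P| …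
  Taking into account Lemma 3.6, it is sufficient to construct r satisfying Σ_{i∈Ph(IClos(s^{[l]}))} (1 − r_i) ≥ min(|P[s^{[l]}]|, |Ph(IClos(s^{[l]}))|)
  (3.9) instead of (3.8). To construct r we start from r_i = 1 for all i and perform the following operation sequentially for l = L, L−1, …, 1:
  if (3.9) is not satisfied for l, then change some r_i for i ∈ Ph(IClos(s^{[l]})) to zero to satisfy [(3.9) with equality]. It is clear that
  performing this operation for a given l will not spoil the verity of (3.9) for the greater l (because r_i are only decreased). Also … r_i = 1
  for all i ∉ Ph(IClos(s^{[l]})) and Σ_i (1 − r_i) ≤ |P| … This guarantees that Σ_i r_i = |Ph(E(G))| − |P| after performing all operations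
  (because |P| ≤ |Ph(E(G))|)."

THE MODEL (`PathSkeleton`, the one modelling step). A QED graph without lepton loops contributing to the magnetic moment has one lepton path;
number its vertices 0, …, N along the path and its internal lepton lines 0, …, N−1 (line k joins vertices k and k+1). Every vertex carries
exactly one photon end; one vertex `ext` carries the external photon; the internal photons are recorded as pairs (u, v) of vertices with
u < v ≤ N, pairwise sharing no vertex and avoiding `ext` (`inj`, `ext_free`). LPath((u, v)) = the lines u, …, v−1 = `Finset.Ico u v`. The
standing restriction "ω(s) < 0 except ∅, E(G)" is used, exactly as in the printed case 2, in the form `NoSelfEnergyBlock`: every vertex interval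
[a, b] with at least one line (a < b) that does not contain `ext` is LEFT by some internal photon (one end inside, one outside) — otherwise the
lines a, …, b−1 with the photons inside form a connected line set with N_lepton = 2, N_photon = 0, i.e. ω = ½ ≥ 0, a lepton self-energy subgraph.
(Only "≤ one photon end per vertex" is needed, not "exactly one".)

WHAT THE KERNEL CERTIFIES: **`two_mul_card_captured_le`** — for every set T of lepton lines, 2·|{i ∈ Ph(E(G)) : LPath(i) ⊆ T}| ≤ |T|, hence
**`card_captured_le_half`**: |Ph⋆(s)| ≤ ⌊|Lept(s)|/2⌋ with Ph⋆(s) = {i : LPath(i) ⊆ s} = Ph(IClos(Lept(s))) (the photon lines inside s are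
irrelevant to both sides). The proof is the printed one made injective: the endpoints of captured photons ("photons with ends on h_j") are
pairwise distinct vertices (`card_owned`); sending an endpoint w to the T-line on its left (or, for the left boundary vertex of a run h_j, to the
T-line left of the first vertex of h_j NOT occupied by a captured photon — which exists because otherwise h_j's vertex interval is a self-energy
block, the printed case 2) is an injection into T (`exists_injOn_owned`). The paper's "⌊|h_j|/2⌋ per path, summed" is thereby obtained without
enumerating the runs. **`exists_weights_captured` = Lemma 3.7 in the same reading**: along ANY descending chain T₁ ⊇ T₂ ⊇ ⋯ of lepton-line sets
ending in ∅ (in print T_l = Lept(s^{[l]})) and for any pairing P of the lepton lines by disjoint pairs with |P| ≤ |Ph(E(G))|, there are weights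
r_i ∈ {0,1} with Σ_i r_i = |Ph(E(G))| − |P| and Σ_{i∈Ph⋆(T_l)} r_i + |P[T_l]| ≤ ⌊|T_l|/2⌋ at every level ((3.8) in additive form) — the printed
construction: (3.9)'s zero-targets min(|P[T_l]|, |Ph⋆(T_l)|) are monotone along the chain and are met greedily from the smallest set upward
(`nested_targets`), then Lemma 3.6 (`two_mul_card_captured_le`) or the pair count (`two_mul_card_pairsInside_le`) gives (3.8).
NOT claimed: the literal statements with Ph(IClos(s)) ⊇ Ph(s) (false, `DenominatorSectorExponent.oneLoop_readings`); Lemma 3.5 and the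
assembly of Theorem 3.1; anything with lepton loops.
-/

namespace Literature.MathematicalPhysics.QuantumFieldTheory.Volkov2020

open Finset

/-- An end of the photon `p = (u, v)` is the vertex `w`. [cite: Volkov2020, §2.1 (journal p.7; tex l.166–170)] -/
def IsEnd (p : ℕ × ℕ) (w : ℕ) : Prop := p.1 = w ∨ p.2 = w

/-- `IsEnd` is decidable (a disjunction of equalities of naturals). [folklore] -/
instance (p : ℕ × ℕ) (w : ℕ) : Decidable (IsEnd p w) := inferInstanceAs (Decidable (_ ∨ _))

/-- **The combinatorial skeleton of a QED graph without lepton loops**: lepton path with vertices 0…N and lines 0…N−1 (line k joins k, k+1),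
internal photons as vertex pairs (u, v), u < v ≤ N, at most one photon end per vertex, the external photon's vertex `ext` free of internal
photons. [cite: Volkov2020, §2.1 (journal p.6–7; tex l.140–170)] -/
structure PathSkeleton where
  /-- number of internal lepton lines (vertices are 0, …, N) -/
  N : ℕ
  /-- internal photons as (left end, right end) -/
  ph : Finset (ℕ × ℕ)
  /-- the vertex carrying the external photon -/
  ext : ℕ
  lt_of_mem : ∀ p ∈ ph, p.1 < p.2
  le_of_mem : ∀ p ∈ ph, p.2 ≤ N
  ext_le : ext ≤ N
  /-- QED valence: a vertex carries at most one internal photon end -/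
  inj : ∀ p ∈ ph, ∀ q ∈ ph, ∀ w, IsEnd p w → IsEnd q w → p = q
  /-- the external vertex carries no internal photon -/
  ext_free : ∀ p ∈ ph, ¬ IsEnd p ext

namespace PathSkeleton

variable (G : PathSkeleton)

/-- **LPath(i) AS PRINTED**: the lepton lines on the path between the ends of photon i = lines u, …, v−1 for i = (u, v).
[cite: Volkov2020, §2.1 (journal p.7; tex l.168–170)] -/
def lpath (p : ℕ × ℕ) : Finset ℕ := Finset.Ico p.1 p.2

/-- **Ph⋆(T)**: the photons CAPTURED by a set T of lepton lines, {i ∈ Ph(E(G)) : LPath(i) ⊆ T} = Ph(IClos(T)) for a set of LEPTON lines T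
(the reading of §3.2's "Ph(IClos(s))" under which Lemmas 3.6–3.7 hold, `DenominatorSectorExponent`). [cite: Volkov2020, §2.1 I-closure (journal p.7; tex l.171–173)] -/
def captured (T : Finset ℕ) : Finset (ℕ × ℕ) := G.ph.filter fun p => lpath p ⊆ T

/-- **No lepton self-energy block** — the standing restriction "ω(s) < 0 for all s except ∅, E(G)" in the form used by Lemma 3.6's case 2:
every vertex interval [a, b] with a < b not containing the external vertex is left by some internal photon (exactly one end inside).
[cite: Volkov2020, §2.1 restriction and proof of Lemma 3.6, case 2 with fn 24 (journal p.7, p.13; tex l.163–164, l.455–458)] -/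
def NoSelfEnergyBlock : Prop :=
  ∀ a b : ℕ, a < b → b ≤ G.N → ¬ (a ≤ G.ext ∧ G.ext ≤ b) →
    ∃ q ∈ G.ph, (a ≤ q.1 ∧ q.1 ≤ b) ∧ ¬ (a ≤ q.2 ∧ q.2 ≤ b) ∨ ¬ (a ≤ q.1 ∧ q.1 ≤ b) ∧ (a ≤ q.2 ∧ q.2 ≤ b)

/-- The vertices occupied by captured photons ("photons with ends on h_j contributing to |Ph(IClos(s))|").
[cite: Volkov2020, proof of Lemma 3.6 (journal p.13; tex l.452–455)] -/
def owned (T : Finset ℕ) : Finset ℕ := (G.captured T).biUnion fun p => {p.1, p.2}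

variable {G}

/-- Membership in `captured`. [cite: Volkov2020, §2.1 (journal p.7)] -/
theorem mem_captured {T : Finset ℕ} {p : ℕ × ℕ} : p ∈ G.captured T ↔ p ∈ G.ph ∧ Finset.Ico p.1 p.2 ⊆ T := by
  unfold captured lpath; rw [Finset.mem_filter]

/-- Membership in `owned`: w is an end of a captured photon. [cite: Volkov2020, proof of Lemma 3.6 (journal p.13)] -/
theorem mem_owned {T : Finset ℕ} {w : ℕ} : w ∈ G.owned T ↔ ∃ p ∈ G.captured T, IsEnd p w := by
  unfold owned IsEnd
  simp only [Finset.mem_biUnion, Finset.mem_insert, Finset.mem_singleton]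
  constructor
  · rintro ⟨p, hp, h⟩
    refine ⟨p, hp, ?_⟩
    rcases h with h | h
    · exact Or.inl h.symm
    · exact Or.inr h.symm
  · rintro ⟨p, hp, h⟩
    refine ⟨p, hp, ?_⟩
    rcases h with h | h
    · exact Or.inl h.symm
    · exact Or.inr h.symm

/-- Owned vertices lie on the path (≤ N). [cite: Volkov2020, §2.1 (journal p.7)] -/
theorem le_N_of_mem_owned {T : Finset ℕ} {w : ℕ} (hw : w ∈ G.owned T) : w ≤ G.N := by
  obtain ⟨p, hp, h⟩ := mem_owned.1 hw
  have hph := (mem_captured.1 hp).1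
  rcases h with h | h
  · have := G.lt_of_mem p hph; have := G.le_of_mem p hph; omega
  · have := G.le_of_mem p hph; omega

/-- **Each captured photon occupies two vertices, all distinct**: |owned| = 2·|captured| (QED valence). [cite: Volkov2020, proof of Lemma 3.6 (journal p.13; tex l.452–455)] -/
theorem card_owned (T : Finset ℕ) : (G.owned T).card = 2 * (G.captured T).card := by
  have hdisj : ((G.captured T : Finset (ℕ × ℕ)) : Set (ℕ × ℕ)).PairwiseDisjoint (fun p => ({p.1, p.2} : Finset ℕ)) := by
    intro p hp q hq hpq
    rw [Function.onFun, Finset.disjoint_left]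
    intro w hwp hwq
    simp only [Finset.mem_insert, Finset.mem_singleton] at hwp hwq
    rw [Finset.mem_coe] at hp hq
    have hp' := (mem_captured.1 hp).1
    have hq' := (mem_captured.1 hq).1
    apply hpq
    refine G.inj p hp' q hq' w ?_ ?_
    · rcases hwp with h | h
      · exact Or.inl h.symm
      · exact Or.inr h.symm
    · rcases hwq with h | h
      · exact Or.inl h.symm
      · exact Or.inr h.symm
  have h2 : ∀ p ∈ G.captured T, ({p.1, p.2} : Finset ℕ).card = 2 := fun p hp => by
    have hlt := G.lt_of_mem p (mem_captured.1 hp).1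
    rw [Finset.card_insert_of_notMem (by rw [Finset.mem_singleton]; exact hlt.ne), Finset.card_singleton]
  unfold owned
  rw [Finset.card_biUnion hdisj, Finset.sum_const_nat h2, Nat.mul_comm]

/-- A left end u of a captured photon has the line u (to its right) in T. [cite: Volkov2020, §2.1 LPath (journal p.7)] -/
theorem mem_of_left_end {T : Finset ℕ} {p : ℕ × ℕ} (hp : p ∈ G.captured T) : p.1 ∈ T := by
  obtain ⟨hph, hsub⟩ := mem_captured.1 hp
  exact hsub (Finset.mem_Ico.2 ⟨le_rfl, G.lt_of_mem p hph⟩)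

/-- A right end v of a captured photon has the line v−1 (to its left) in T, and v ≥ 1. [cite: Volkov2020, §2.1 LPath (journal p.7)] -/
theorem mem_of_right_end {T : Finset ℕ} {p : ℕ × ℕ} (hp : p ∈ G.captured T) : 1 ≤ p.2 ∧ p.2 - 1 ∈ T := by
  obtain ⟨hph, hsub⟩ := mem_captured.1 hp
  have hlt := G.lt_of_mem p hph
  refine ⟨by omega, hsub (Finset.mem_Ico.2 ⟨by omega, by omega⟩)⟩

/-- The left-boundary owned vertices: owned w with no T-line on its left (w = 0 or line w−1 ∉ T). Such a w is a LEFT end of its photon, so the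
line w is in T. [cite: Volkov2020, proof of Lemma 3.6 (journal p.13)] -/
theorem boundary_is_left_end {T : Finset ℕ} {w : ℕ} (hw : w ∈ G.owned T) (hb : w = 0 ∨ w - 1 ∉ T) :
    ∃ p ∈ G.captured T, p.1 = w := by
  obtain ⟨p, hp, h⟩ := mem_owned.1 hw
  rcases h with h | h
  · exact ⟨p, hp, h⟩
  · exfalso
    obtain ⟨h1, h2⟩ := mem_of_right_end hp
    rw [h] at h1 h2
    rcases hb with hb | hb
    · omega
    · exact hb h2

/-- **The self-energy block argument (printed case 2)**: if an owned left-boundary vertex w starts a stretch of owned vertices w, …, b whose lines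
w, …, b−1 are in T while the line b is not (w < b), then [w, b] is a lepton self-energy block — impossible under `NoSelfEnergyBlock`.
[cite: Volkov2020, proof of Lemma 3.6, case 2 (journal p.13; tex l.455–458)] -/
theorem no_fully_owned_run (hG : G.NoSelfEnergyBlock) {T : Finset ℕ} {w b : ℕ} (hwb : w < b)
    (hb : w = 0 ∨ w - 1 ∉ T) (hown : ∀ y, w ≤ y → y ≤ b → y ∈ G.owned T) (hline : b ∉ T) : False := by
  have hbN : b ≤ G.N := le_N_of_mem_owned (hown b hwb.le le_rfl)
  -- the external vertex is not in [w, b]: it carries no internal photon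
  have hext : ¬ (w ≤ G.ext ∧ G.ext ≤ b) := by
    rintro ⟨h1, h2⟩
    obtain ⟨p, hp, hend⟩ := mem_owned.1 (hown G.ext h1 h2)
    exact G.ext_free p (mem_captured.1 hp).1 hend
  obtain ⟨q, hq, hone⟩ := hG w b hwb hbN hext
  -- the end of q inside [w, b] is owned, hence q itself is captured (one photon per vertex)
  have hcap : ∀ y, IsEnd q y → w ≤ y → y ≤ b → q ∈ G.captured T := by
    intro y hy h1 h2
    obtain ⟨p, hp, hpy⟩ := mem_owned.1 (hown y h1 h2)
    have := G.inj p (mem_captured.1 hp).1 q hq y hpy hy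
    exact this ▸ hp
  rcases hone with ⟨⟨h1, h2⟩, hout⟩ | ⟨hout, ⟨h1, h2⟩⟩
  · -- left end inside: then the right end is inside too, else the line b ∈ LPath(q) ⊆ T
    have hqc := hcap q.1 (Or.inl rfl) h1 h2
    obtain ⟨hph, hsub⟩ := mem_captured.1 hqc
    have hlt := G.lt_of_mem q hph
    apply hout
    refine ⟨by omega, ?_⟩
    by_contra hgt
    exact hline (hsub (Finset.mem_Ico.2 ⟨h2, by omega⟩))
  · -- right end inside: then the left end is inside too, else the line w−1 ∈ LPath(q) ⊆ T (or w = 0)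
    have hqc := hcap q.2 (Or.inr rfl) h1 h2
    obtain ⟨hph, hsub⟩ := mem_captured.1 hqc
    have hlt := G.lt_of_mem q hph
    apply hout
    refine ⟨?_, by omega⟩
    by_contra hlt'
    rw [not_le] at hlt'
    rcases hb with hb | hb
    · omega
    · exact hb (hsub (Finset.mem_Ico.2 ⟨by omega, by omega⟩))

/-- For an owned left-boundary vertex w there is a first vertex x > w that is not owned or has no T-line on its left; it exists below N + 2.
[cite: Volkov2020, proof of Lemma 3.6 (journal p.13)] -/
theorem exists_stop (T : Finset ℕ) (w : ℕ) : ∃ x, w < x ∧ (x ∉ G.owned T ∨ x - 1 ∉ T) := by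
  refine ⟨max (w + 1) (G.N + 1), by omega, Or.inl fun h => ?_⟩
  have := le_N_of_mem_owned h
  omega

/-- The stopping vertex x_w of the proof (a `Nat.find`). [cite: Volkov2020, proof of Lemma 3.6 (journal p.13)] -/
def stop (T : Finset ℕ) (w : ℕ) : ℕ := Nat.find (G.exists_stop T w)

/-- The T-line assigned to an owned vertex: the line on its left, or — for a left-boundary vertex — the line left of its stopping vertex.
[cite: Volkov2020, proof of Lemma 3.6 (journal p.13)] -/
def assign (T : Finset ℕ) (w : ℕ) : ℕ :=
  if w = 0 ∨ w - 1 ∉ T then G.stop T w - 1 else w - 1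

/-- Properties of the stopping vertex of an owned left-boundary vertex under `NoSelfEnergyBlock`: it is not owned, and the line on its left IS in
T (the alternative "line ∉ T" would close a self-energy block). [cite: Volkov2020, proof of Lemma 3.6 (journal p.13; tex l.452–458)] -/
theorem stop_spec (hG : G.NoSelfEnergyBlock) {T : Finset ℕ} {w : ℕ} (hw : w ∈ G.owned T) (hb : w = 0 ∨ w - 1 ∉ T) :
    w < G.stop T w ∧ G.stop T w ∉ G.owned T ∧ G.stop T w - 1 ∈ T := by
  have hspec : w < G.stop T w ∧ (G.stop T w ∉ G.owned T ∨ G.stop T w - 1 ∉ T) := Nat.find_spec (G.exists_stop T w)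
  have hmin : ∀ y, y < G.stop T w → ¬ (w < y ∧ (y ∉ G.owned T ∨ y - 1 ∉ T)) :=
    fun y hy => Nat.find_min (G.exists_stop T w) hy
  obtain ⟨hwx, hor⟩ := hspec
  -- every vertex strictly between w and the stop is owned with its left line in T
  have hbetween : ∀ y, w < y → y < G.stop T w → y ∈ G.owned T ∧ y - 1 ∈ T := by
    intro y h1 h2
    have hy := hmin y h2
    by_contra hc
    apply hy
    refine ⟨h1, ?_⟩
    by_cases hyo : y ∈ G.owned T
    · right; intro hyT; exact hc ⟨hyo, hyT⟩
    · exact Or.inl hyo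
  -- the line w is in T (w is a left end)
  obtain ⟨p, hp, hpw⟩ := boundary_is_left_end hw hb
  have hwT : w ∈ T := hpw ▸ mem_of_left_end hp
  -- case (i): «line (stop − 1) ∉ T» is impossible — it would close a fully owned run [w, stop − 1]
  have hxT : G.stop T w - 1 ∈ T := by
    by_contra hxT
    have hx2 : w + 2 ≤ G.stop T w := by
      by_contra h
      have : G.stop T w = w + 1 := by omega
      rw [this, Nat.add_sub_cancel] at hxT
      exact hxT hwT
    refine no_fully_owned_run hG (T := T) (w := w) (b := G.stop T w - 1) (by omega) hb (fun y h1 h2 => ?_) hxT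
    rcases Nat.eq_or_lt_of_le h1 with h | h
    · exact h ▸ hw
    · exact (hbetween y h (by omega)).1
  refine ⟨hwx, ?_, hxT⟩
  rcases hor with h | h
  · exact h
  · exact absurd hxT h

/-- **The injection** behind "no more than |h_j|/2 photons with ends on h_j": `assign` maps the owned vertices injectively into T.
[cite: Volkov2020, proof of Lemma 3.6 (journal p.13; tex l.449–458)] -/
theorem exists_injOn_owned (hG : G.NoSelfEnergyBlock) (T : Finset ℕ) :
    (∀ w ∈ G.owned T, G.assign T w ∈ T) ∧ Set.InjOn (G.assign T) (G.owned T : Set ℕ) := by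
  -- the boundary case of `assign` is strictly increasing along boundary vertices
  have key : ∀ {a c : ℕ}, a ∈ G.owned T → c ∈ G.owned T → (c = 0 ∨ c - 1 ∉ T) → a < c →
      G.stop T a - 1 < G.stop T c - 1 := by
    intro a c ha hc hbc hac
    have hle : G.stop T a ≤ c := by
      refine Nat.find_min' (G.exists_stop T a) ⟨hac, Or.inr ?_⟩
      rcases hbc with h | h
      · omega
      · exact h
    have h1 : a < G.stop T a := (Nat.find_spec (G.exists_stop T a)).1
    have h2 := (stop_spec hG hc hbc).1
    omega
  constructor
  · intro w hw
    unfold assign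
    split_ifs with hb
    · exact (stop_spec hG hw hb).2.2
    · by_contra h
      exact hb (Or.inr h)
  · intro w hw w' hw' heq
    rw [Finset.mem_coe] at hw hw'
    unfold assign at heq
    by_cases hb : w = 0 ∨ w - 1 ∉ T <;> by_cases hb' : w' = 0 ∨ w' - 1 ∉ T <;>
      simp only [hb, hb', if_true, if_false] at heq
    · -- both boundary vertices
      by_contra hne
      rcases lt_or_gt_of_ne hne with hlt | hgt
      · exact absurd heq (key hw hw' hb' hlt).ne
      · exact absurd heq (key hw' hw hb hgt).ne'
    · -- w boundary, w' not: stop w = w' would be owned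
      have hw'0 : w' ≠ 0 := fun h => hb' (Or.inl h)
      have hs := stop_spec hG hw hb
      have : G.stop T w = w' := by omega
      exact absurd hw' (this ▸ hs.2.1)
    · have hw0 : w ≠ 0 := fun h => hb (Or.inl h)
      have hs := stop_spec hG hw' hb'
      have : G.stop T w' = w := by omega
      exact absurd hw (this ▸ hs.2.1)
    · have hw0 : w ≠ 0 := fun h => hb (Or.inl h)
      have hw'0 : w' ≠ 0 := fun h => hb' (Or.inl h)
      omega

/-- **Lemma 3.6 (captured-photon reading), doubled form**: for every set T of lepton lines, 2·|{i : LPath(i) ⊆ T}| ≤ |T|.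
[cite: Volkov2020, Lemma 3.6 (journal p.13; tex l.442–459)] -/
theorem two_mul_card_captured_le (hG : G.NoSelfEnergyBlock) (T : Finset ℕ) : 2 * (G.captured T).card ≤ T.card := by
  rw [← card_owned]
  obtain ⟨hmaps, hinj⟩ := exists_injOn_owned hG T
  exact Finset.card_le_card_of_injOn (G.assign T) (fun w hw => hmaps w hw) hinj

/-- **Lemma 3.6 AS PRINTED, in the captured-photon reading**: |Ph⋆(s)| ≤ ⌊|Lept(s)|/2⌋ for every line set s, where Ph⋆(s) = {i ∈ Ph(E(G)) :
LPath(i) ⊆ s} depends only on the lepton lines T = Lept(s) of s. [cite: Volkov2020, Lemma 3.6 (journal p.13; tex l.442–446)] -/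
theorem card_captured_le_half (hG : G.NoSelfEnergyBlock) (T : Finset ℕ) : (G.captured T).card ≤ T.card / 2 := by
  have := two_mul_card_captured_le hG T
  omega

/-! ## Lemma 3.7 in the captured-photon reading: the weights r_i ∈ {0,1} exist along every chain of lepton-line sets -/

/-- The greedy step of Lemma 3.7's proof, abstractly: along an increasing chain of finite sets D₀ ⊆ D₁ ⊆ ⋯ with increasing targets
y₀ ≤ y₁ ≤ ⋯, y_j ≤ |D_j|, y₀ = 0, one set Z ⊆ D_j of size y_j meets every earlier D_m in at least y_m elements ("change some r_i … to zero …
performing this operation for a given l will not spoil the verity … for the greater l (because r_i are only decreased)").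
[cite: Volkov2020, proof of Lemma 3.7 (journal p.14; tex l.475–483)] -/
theorem nested_targets {β : Type*} [DecidableEq β] (D : ℕ → Finset β) (y : ℕ → ℕ) (hD : ∀ j, D j ⊆ D (j + 1))
    (hy : ∀ j, y j ≤ y (j + 1)) (hyD : ∀ j, y j ≤ (D j).card) (hy0 : y 0 = 0) :
    ∀ j, ∃ Z ⊆ D j, Z.card = y j ∧ ∀ m ≤ j, y m ≤ (Z ∩ D m).card := by
  intro j
  induction j with
  | zero => exact ⟨∅, Finset.empty_subset _, by simp [hy0], fun m hm => by rw [Nat.le_zero.1 hm, hy0]; exact Nat.zero_le _⟩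
  | succ j ih =>
    obtain ⟨Z, hZD, hZc, hZm⟩ := ih
    have hZD' : Z ⊆ D (j + 1) := hZD.trans (hD j)
    have havail : y (j + 1) - y j ≤ (D (j + 1) \ Z).card := by
      rw [Finset.card_sdiff_of_subset hZD', hZc]
      exact Nat.sub_le_sub_right (hyD (j + 1)) _
    obtain ⟨t, htsub, htc⟩ := Finset.exists_subset_card_eq havail
    refine ⟨Z ∪ t, Finset.union_subset hZD' (htsub.trans Finset.sdiff_subset), ?_, fun m hm => ?_⟩
    · rw [Finset.card_union_of_disjoint (Finset.disjoint_of_subset_right htsub Finset.disjoint_sdiff), hZc, htc]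
      have := hy j
      omega
    · rcases Nat.lt_or_ge m (j + 1) with hlt | hge
      · refine (hZm m (Nat.lt_succ_iff.1 hlt)).trans (Finset.card_le_card ?_)
        exact Finset.inter_subset_inter_right (Finset.subset_union_left)
      · obtain rfl : m = j + 1 := le_antisymm hm hge
        rw [Finset.inter_eq_left.2 (Finset.union_subset hZD' (htsub.trans Finset.sdiff_subset)),
          Finset.card_union_of_disjoint (Finset.disjoint_of_subset_right htsub Finset.disjoint_sdiff), hZc, htc]
        have := hy j
        omega

/-- `P[T]`: the pairs of the pairing P contained in T ("P[s] = {a ∈ P : a ⊆ s}"). [cite: Volkov2020, §3.1 (journal p.10; tex l.290–294)] -/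
def pairsInside (P : Finset (Finset ℕ)) (T : Finset ℕ) : Finset (Finset ℕ) := P.filter fun a => a ⊆ T

/-- Disjoint pairs inside T number at most ⌊|T|/2⌋ (used silently in the printed "it is sufficient to construct r satisfying (3.9) instead of (3.8)").
[cite: Volkov2020, proof of Lemma 3.7 (journal p.14; tex l.470–474)] -/
theorem two_mul_card_pairsInside_le (P : Finset (Finset ℕ)) (hP2 : ∀ a ∈ P, a.card = 2)
    (hPd : (P : Set (Finset ℕ)).PairwiseDisjoint id) (T : Finset ℕ) : 2 * (pairsInside P T).card ≤ T.card := by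
  have hsub : (pairsInside P T).biUnion id ⊆ T := by
    intro x hx
    obtain ⟨a, ha, hxa⟩ := Finset.mem_biUnion.1 hx
    exact (Finset.mem_filter.1 ha).2 hxa
  have hdisj : ((pairsInside P T : Finset (Finset ℕ)) : Set (Finset ℕ)).PairwiseDisjoint id :=
    hPd.subset (by intro a ha; exact (Finset.mem_filter.1 ha).1)
  have hcard : ((pairsInside P T).biUnion id).card = 2 * (pairsInside P T).card := by
    rw [Finset.card_biUnion hdisj, Finset.sum_const_nat (m := 2) fun a ha => ?_, Nat.mul_comm]
    exact hP2 a (Finset.mem_filter.1 ha).1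
  rw [← hcard]
  exact Finset.card_le_card hsub

/-- `pairsInside` is monotone in T. [cite: Volkov2020, §3.1 (journal p.10)] -/
theorem pairsInside_mono (P : Finset (Finset ℕ)) {T T' : Finset ℕ} (h : T ⊆ T') : pairsInside P T ⊆ pairsInside P T' := by
  intro a ha
  rw [pairsInside, Finset.mem_filter] at ha ⊢
  exact ⟨ha.1, ha.2.trans h⟩

/-- `captured` is monotone in T (Ph⋆ grows with the line set — why the printed top-down construction never spoils a higher level).
[cite: Volkov2020, proof of Lemma 3.7 (journal p.14; tex l.482)] -/
theorem captured_mono {T T' : Finset ℕ} (h : T ⊆ T') : G.captured T ⊆ G.captured T' := by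
  intro p hp
  rw [mem_captured] at hp ⊢
  exact ⟨hp.1, hp.2.trans h⟩

/-- No photon is captured by the empty line set. [cite: Volkov2020, §2.1 (journal p.7)] -/
theorem captured_empty : G.captured ∅ = ∅ := by
  ext p
  simp only [Finset.notMem_empty, iff_false]
  intro hp
  obtain ⟨hph, hsub⟩ := mem_captured.1 hp
  have hlt := G.lt_of_mem p hph
  exact Finset.notMem_empty _ (hsub (Finset.mem_Ico.2 ⟨le_rfl, hlt⟩))

/-- Summing the weights r = 𝟙[· ∉ Z] over a set counts its elements outside Z. [folklore] -/
private theorem sum_compl_indicator (s Z : Finset (ℕ × ℕ)) :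
    ∑ i ∈ s, (if i ∈ Z then 0 else 1) = s.card - (s ∩ Z).card := by
  have h1 : ∑ i ∈ s, (if i ∈ Z then 0 else 1) = ∑ i ∈ s, (if ¬ i ∈ Z then 1 else 0) :=
    Finset.sum_congr rfl fun i _ => by by_cases h : i ∈ Z <;> simp [h]
  rw [h1, ← Finset.card_filter, Finset.filter_not, Finset.filter_mem_eq_inter,
    Finset.card_sdiff_of_subset Finset.inter_subset_left]

/-- A descending chain of line sets that reaches ∅ stays ∅. [folklore] -/
private theorem chain_eq_empty {T : ℕ → Finset ℕ} (hT : ∀ l, T (l + 1) ⊆ T l) {l₀ : ℕ} (hT0 : T l₀ = ∅) :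
    ∀ l, l₀ ≤ l → T l = ∅ := by
  intro l hl
  induction l with
  | zero =>
    obtain rfl : l₀ = 0 := Nat.le_zero.1 hl
    exact hT0
  | succ l ih =>
    rcases Nat.lt_or_ge l₀ (l + 1) with h | h
    · exact Finset.subset_empty.1 ((hT l).trans (ih (by omega)).subset)
    · obtain rfl : l₀ = l + 1 := le_antisymm hl h
      exact hT0

/-- **Lemma 3.7 in the captured-photon reading**, along an arbitrary descending chain of lepton-line sets T₁ ⊇ T₂ ⊇ ⋯ ending in ∅ (in print:
T_l = Lept(s^{[l]}), the lepton lines among the l smallest… largest-index Feynman parameters; s^{[L+1]} = ∅): for a pairing P of the lepton lines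
by disjoint pairs with |P| ≤ |Ph(E(G))|, there are weights r_i ∈ {0,1} on the internal photons with Σ_i r_i = |Ph(E(G))| − |P| and, at every level,
Σ_{i ∈ Ph⋆(T_l)} r_i + |P[T_l]| ≤ ⌊|T_l|/2⌋ — the printed (3.8) with Ph(IClos(s^{[l]})) read as Ph⋆, in additive form. The proof is the printed
one: Lemma 3.6 (`two_mul_card_captured_le`) reduces (3.8) to "(3.9): at least min(|P[T_l]|, |Ph⋆(T_l)|) zeros inside Ph⋆(T_l)", and the zeros are
placed greedily from the smallest set upward (`nested_targets`), never more than |P| of them. [cite: Volkov2020, Lemma 3.7 with (3.8)–(3.9) (journal p.14; tex l.460–484)] -/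
theorem exists_weights_captured (hG : G.NoSelfEnergyBlock) (P : Finset (Finset ℕ)) (hP2 : ∀ a ∈ P, a.card = 2)
    (hPd : (P : Set (Finset ℕ)).PairwiseDisjoint id) (hPle : P.card ≤ G.ph.card)
    (T : ℕ → Finset ℕ) (hT : ∀ l, T (l + 1) ⊆ T l) (l₀ : ℕ) (hT0 : T l₀ = ∅) :
    ∃ r : ℕ × ℕ → ℕ, (∀ i, r i ≤ 1) ∧ ∑ i ∈ G.ph, r i = G.ph.card - P.card ∧
      ∀ l, ∑ i ∈ G.captured (T l), r i + (pairsInside P (T l)).card ≤ (T l).card / 2 := by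
  classical
  -- reindex the chain increasingly: D j = Ph⋆(T (l₀ − j)), targets y j = min(|P[T]|, |Ph⋆(T)|)
  set D : ℕ → Finset (ℕ × ℕ) := fun j => G.captured (T (l₀ - j)) with hDdef
  set y : ℕ → ℕ := fun j => min (pairsInside P (T (l₀ - j))).card (G.captured (T (l₀ - j))).card with hydef
  have hTmono : ∀ j, T (l₀ - j) ⊆ T (l₀ - (j + 1)) := by
    intro j
    rcases Nat.lt_or_ge j l₀ with hj | hj
    · have : l₀ - j = (l₀ - (j + 1)) + 1 := by omega
      rw [this]; exact hT _
    · have h1 : l₀ - j = 0 := by omega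
      have h2 : l₀ - (j + 1) = 0 := by omega
      rw [h1, h2]
  have hD : ∀ j, D j ⊆ D (j + 1) := fun j => captured_mono (hTmono j)
  have hy : ∀ j, y j ≤ y (j + 1) := fun j =>
    min_le_min (Finset.card_le_card (pairsInside_mono P (hTmono j))) (Finset.card_le_card (captured_mono (hTmono j)))
  have hyD : ∀ j, y j ≤ (D j).card := fun j => min_le_right _ _
  have hy0 : y 0 = 0 := by
    show min (pairsInside P (T (l₀ - 0))).card (G.captured (T (l₀ - 0))).card = 0
    rw [Nat.sub_zero, hT0, captured_empty, Finset.card_empty, Nat.min_zero]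
  obtain ⟨Z, hZD, hZc, hZm⟩ := nested_targets D y hD hy hyD hy0 l₀
  -- Z ⊆ Ph⋆(T 0) ⊆ Ph(E(G)), |Z| ≤ |P[T 0]| ≤ |P| ≤ |Ph|; enlarge to exactly |P| zeros
  have hZph : Z ⊆ G.ph := hZD.trans (Finset.filter_subset _ _)
  have hZle : Z.card ≤ P.card := by
    rw [hZc]; exact (min_le_left _ _).trans (Finset.card_le_card (Finset.filter_subset _ _))
  obtain ⟨t, htsub, htc⟩ := Finset.exists_subset_card_eq (s := G.ph \ Z) (n := P.card - Z.card)
    (by rw [Finset.card_sdiff_of_subset hZph]; omega)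
  set Z' := Z ∪ t with hZ'
  have hZ't : Disjoint Z t := Finset.disjoint_of_subset_right htsub Finset.disjoint_sdiff
  have hZ'ph : Z' ⊆ G.ph := Finset.union_subset hZph (htsub.trans Finset.sdiff_subset)
  have hZ'c : Z'.card = P.card := by
    rw [hZ', Finset.card_union_of_disjoint hZ't, htc]; omega
  refine ⟨fun i => if i ∈ Z' then 0 else 1, fun i => by show (if i ∈ Z' then 0 else 1) ≤ 1; split_ifs <;> omega, ?_, fun l => ?_⟩
  · -- Σ_{Ph} r = |Ph| − |Z'|
    show ∑ i ∈ G.ph, (if i ∈ Z' then 0 else 1) = G.ph.card - P.card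
    rw [sum_compl_indicator, Finset.inter_eq_right.2 hZ'ph, hZ'c]
  · -- level l: Σ_{Ph⋆(T_l)} r = |Ph⋆| − |Ph⋆ ∩ Z'| ≤ |Ph⋆| − y, then Lemma 3.6 or the pairs bound
    show ∑ i ∈ G.captured (T l), (if i ∈ Z' then 0 else 1) + (pairsInside P (T l)).card ≤ (T l).card / 2
    rw [sum_compl_indicator]
    have h36 := two_mul_card_captured_le hG (T l)
    have hpairs := two_mul_card_pairsInside_le P hP2 hPd (T l)
    rcases Nat.lt_or_ge l₀ l with hl | hl
    · -- beyond the end of the chain everything is empty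
      have hTl : T l = ∅ := chain_eq_empty hT hT0 l hl.le
      rw [hTl, captured_empty]
      simp only [Finset.empty_inter, Finset.card_empty, Nat.sub_zero, zero_add, Nat.zero_div]
      rw [Nat.le_zero, Finset.card_eq_zero, pairsInside, Finset.filter_eq_empty_iff]
      intro a ha hsub
      have := hP2 a ha
      rw [Finset.subset_empty.1 hsub] at this
      simp at this
    · -- level l = l₀ − j with j = l₀ − l ≤ l₀
      have hj : l = l₀ - (l₀ - l) := by omega
      have hmeet := hZm (l₀ - l) (Nat.sub_le _ _)
      simp only [hDdef, hydef] at hmeet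
      rw [← hj] at hmeet
      -- |Ph⋆ ∩ Z'| ≥ |Ph⋆ ∩ Z| ≥ y
      have hge : min (pairsInside P (T l)).card (G.captured (T l)).card ≤ (G.captured (T l) ∩ Z').card := by
        refine hmeet.trans ?_
        rw [Finset.inter_comm]
        exact Finset.card_le_card (Finset.inter_subset_inter_left Finset.subset_union_left)
      have hle_cap : (G.captured (T l) ∩ Z').card ≤ (G.captured (T l)).card := Finset.card_le_card Finset.inter_subset_left
      rcases le_total (pairsInside P (T l)).card (G.captured (T l)).card with hcase | hcase
      · rw [min_eq_left hcase] at hge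
        omega
      · rw [min_eq_right hcase] at hge
        omega

/-- Non-vacuity: the one-loop vertex graph (lepton lines 0, 1; photon (0, 2); external photon at vertex 1) is a `PathSkeleton` satisfying
`NoSelfEnergyBlock`, and its photon is captured exactly by T ⊇ {0, 1}. [cite: Volkov2020, §2.1 (journal p.7)] -/
def oneLoop : PathSkeleton where
  N := 2
  ph := {(0, 2)}
  ext := 1
  lt_of_mem := by intro p hp; rw [Finset.mem_singleton] at hp; subst hp; decide
  le_of_mem := by intro p hp; rw [Finset.mem_singleton] at hp; subst hp; decide
  ext_le := by decide
  inj := by intro p hp q hq _ _ _; rw [Finset.mem_singleton] at hp hq; rw [hp, hq]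
  ext_free := by intro p hp; rw [Finset.mem_singleton] at hp; subst hp; decide

/-- The one-loop skeleton has no self-energy block (every proper vertex interval avoiding the external vertex 1 is {0} or {2}, which have no
line, or is left by the photon). [cite: Volkov2020, §2.1 restriction (journal p.7)] -/
theorem oneLoop_noSelfEnergyBlock : oneLoop.NoSelfEnergyBlock := by
  intro a b hab hb hext
  refine ⟨(0, 2), Finset.mem_singleton_self _, ?_⟩
  change b ≤ 2 at hb
  change ¬ (a ≤ 1 ∧ 1 ≤ b) at hext
  change (a ≤ 0 ∧ 0 ≤ b) ∧ ¬ (a ≤ 2 ∧ 2 ≤ b) ∨ ¬ (a ≤ 0 ∧ 0 ≤ b) ∧ (a ≤ 2 ∧ 2 ≤ b)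
  omega

/-- On the one-loop skeleton the bound reads |Ph⋆({0,1})| = 1 ≤ ⌊2/2⌋ and |Ph⋆({1})| = 0 ≤ ⌊1/2⌋. [cite: Volkov2020, Lemma 3.6 (journal p.13)] -/
theorem oneLoop_captured : (oneLoop.captured {0, 1}).card = 1 ∧ (oneLoop.captured {1}).card = 0 := by
  have h1 : oneLoop.captured {0, 1} = {(0, 2)} := by
    unfold captured lpath
    change Finset.filter (fun p : ℕ × ℕ => Finset.Ico p.1 p.2 ⊆ {0, 1}) {(0, 2)} = {(0, 2)}
    rw [Finset.filter_singleton, if_pos]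
    decide
  have h2 : oneLoop.captured {1} = ∅ := by
    unfold captured lpath
    change Finset.filter (fun p : ℕ × ℕ => Finset.Ico p.1 p.2 ⊆ {1}) {(0, 2)} = ∅
    rw [Finset.filter_singleton, if_neg]
    decide
  rw [h1, h2]
  exact ⟨Finset.card_singleton _, Finset.card_empty⟩

end PathSkeleton

end Literature.MathematicalPhysics.QuantumFieldTheory.Volkov2020
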